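import Summits.AtomisticToContinuum.Crystallization.Theorems.ChartedZeroExcessLayeredLatticeLiouvilleXN

/-!
# Zero-excess layered lattice Liouville — part XO (lens-2 g59, node «SBGlueC4c»): the TOWER — level states, the invariant, and its consequences

Critic rows 1133/1135 (C4 «iterate with re-charting: drift budget `C_R·Σm ≤ min(c₀,κ₀)/2`, the coherence slack `δ_*` re-verified at every level with `ϑ₁, ω₁`
fixed before `K₀`, the history term»), leaf (2) `SubWindowBudgetGlueBPG` of `stmt-AtomisticToContinuum-26636`.

* XO.1 `Lev` — a LEVEL STATE `(L, w, w₁, D, DM)`: the re-charted equilibrium chart `(L, w)` with its layered indexation `w₁` (`Layered (chartGen₁ L) (chartGen₂ L) w₁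
  = LayeredHom L w`), the accumulated DRIFT `D` (index-Lipschitz constant of `lsite_ℓ − lsite_0`) and the accumulated MODE SIZE `DM = Σ m_M` (the (RC) strain
  parameter: chart class `(1/50 + C_R·DM, 2 + C_R·DM)`, energy-nearness `1/2000 + C_R·DM`, certificates `c₀ − C_R·DM`, `C₁ + C_R·DM`, `κ₀ − C_R·DM`).  The
  registration of a level is `levΨ = transReg Ψ₀ (chart 0) (chart ℓ)` (FIXED atom map of chart 0) and its displacement `levφ = pullDisp S Ψ_ℓ (chart ℓ)`.
* XO.2 `TH` — the fixed data of a tower, bundled: the constants `K : SBK` with `K.OK`; the door set `S`; the original registration `Ψ₀` of chart 0 `st₀` (the (hU♭)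
  chart: crystal `c₀`, tame `C₁`, coercive `κ₀`); the centre `x = atomOf X₀`, `‖x‖ < 8R`; the packages (PT), (I1) at `CT`, (HC)/(LD) above the floors
  `(c₀/2, 2C₁, κ₀/2)` (XD `floor_packages`), the (I4ˢ) instance at `(εf, ϱ, AT)`, the (RC) instance at `(ε, ϱ, m₀, C_R)` — exactly the tails of
  `TailFluxBSP 1 3 (1/16) (1/25)` and `EquilChartStrainP (1/25) 3 (1/1000)`.
* XO.3 `LevOK`, `TowerInv` — the INVARIANT after `ℓ` levels: every level `i ≤ ℓ` is a certified chart of the class above with `DM_i ≤ μpart i`, `D_i ≤ 2DM_i`, the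
  PROFILE BOUND `E(φ_i)(B_{X₀, n i}) ≤ p i·#B_{n i}`; PAIRWISE drifts `lsite_i − lsite_k` are `(D_i − D_k)`-index-Lipschitz (`k ≤ i`), consecutive drifts
  `D_{i+1} − D_i ≤ 2√(Cm·p i)` (the RECENT-DRIFT bookkeeping of the history term).
* XO.4 consequences at a level on the tower (`n i ≥ nlo`): floors, cleanliness, bijectivity, tear-freeness `4 ↦ 9`/`3 ↦ 8` of `Ψ_i` (XE, drift `≤ 2μ_M ≤ c₀/16`), the
  chart class `(1/25, 3)` for (I4ˢ), the coherence region inside the root window `9R`, and the level-0 instance of the invariant (registration energy `≤ P₀·n₀³`).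
-/

noncomputable section

open scoped BigOperators InnerProductSpace RealInnerProductSpace
open Set Function Metric
open Summit.AtomisticToContinuum.Crystallization.Theorems.ChartedPlanarOrderRigidityDoor (E3 IsClean IsNash atomsIn)
open Summit.AtomisticToContinuum.Crystallization.Theorems.ChartedPlanarOrderDensityDichotomy (μS IsSep nK nK_nonneg)
open Summit.AtomisticToContinuum.Crystallization.Theorems.ChartedPlanarOrderCleanScaleP (IsCleanP IsDoorSetP isCleanP_one_iff)
open Summit.AtomisticToContinuum.Crystallization.Theorems.ChartedPlanarOrderMesoCut (LayeredHom)
open Summit.AtomisticToContinuum.Crystallization.Theorems.ChartedPlanarOrderDoorLayered (Layered layeredHom_eq_layered atomsIn_subset)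
open Summit.AtomisticToContinuum.Crystallization.Theorems.ChartedPlanarOrderDoorLayeredOsc (IsTwoShellAffineGood)

namespace Summit.AtomisticToContinuum.Crystallization.Theorems.ChartedZeroExcessLayeredLatticeLiouville

/-! ### XO.1  Level states -/

/-- a LEVEL STATE of the tower: chart `(L, w)`, its layered indexation `w₁`, accumulated drift `D` and accumulated mode size `DM`. [this file, g59] -/
structure Lev where
  (L : E3 ≃L[ℝ] E3)
  (w w₁ : ℤ → E3)
  (D DM : ℝ)

/-- the registration of a level: the ORIGINAL atom map of chart 0 `st₀` re-read in the indexation of the level's chart (`transReg`, XD). -/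
def levΨ (Ψ₀ : E3 → E3) (st₀ lv : Lev) : E3 → E3 :=
  transReg Ψ₀ (chartGen₁ st₀.L) (chartGen₂ st₀.L) st₀.w₁ (chartGen₁ lv.L) (chartGen₂ lv.L) lv.w₁

/-- the pulled-back displacement of a level. -/
def levφ (S : Set E3) (Ψ₀ : E3 → E3) (st₀ lv : Lev) : Cell 2 → ℤ → E3 :=
  pullDisp S (levΨ Ψ₀ st₀ lv) (chartGen₁ lv.L) (chartGen₂ lv.L) lv.w₁

/-- `levΨ_def` (docstring added by the landing lane; see the module docstring). [formal bookkeeping] -/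
theorem levΨ_def (Ψ₀ : E3 → E3) (st₀ lv : Lev) :
    levΨ Ψ₀ st₀ lv = transReg Ψ₀ (chartGen₁ st₀.L) (chartGen₂ st₀.L) st₀.w₁ (chartGen₁ lv.L) (chartGen₂ lv.L) lv.w₁ := rfl

/-- `levφ_def` (docstring added by the landing lane; see the module docstring). [formal bookkeeping] -/
theorem levφ_def (S : Set E3) (Ψ₀ : E3 → E3) (st₀ lv : Lev) :
    levφ S Ψ₀ st₀ lv = pullDisp S (transReg Ψ₀ (chartGen₁ st₀.L) (chartGen₂ st₀.L) st₀.w₁ (chartGen₁ lv.L) (chartGen₂ lv.L) lv.w₁)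
      (chartGen₁ lv.L) (chartGen₂ lv.L) lv.w₁ := rfl

/-! ### XO.2  The fixed data of a tower -/

/-- ★ the hypotheses of a tower, bundled (module docstring XO.2). [this file, g59] -/
structure TH (K : SBK) (S : Set E3) (Ψ₀ : E3 → E3) (st₀ : Lev) (x : E3) (X₀ : Cell 2 × ℤ) : Prop where
  ok : K.OK
  door : IsDoorSetP 1 K.δ S
  affine : ∀ q ∈ S, IsTwoShellAffineGood (1 / 16) S q
  iso : IsBondIso S Ψ₀
  reg : IsGlobalReg K.Cg K.η K.R S (LayeredHom (st₀.L : E3 →L[ℝ] E3) st₀.w) Ψ₀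
  coh : IsCoherentBy K.ϑ₁ K.ω₁ S Ψ₀ (atomsIn (μS S) 0 (9 * K.R))
  chart₀ : IsEquilChart K.a (1 / 50) 2 st₀.L st₀.w
  near₀ : IsEnergyNear (1 / 2000) (LayeredHom (st₀.L : E3 →L[ℝ] E3) st₀.w)
  lay₀ : Layered (chartGen₁ st₀.L) (chartGen₂ st₀.L) st₀.w₁ = LayeredHom (st₀.L : E3 →L[ℝ] E3) st₀.w
  cryst₀ : IsLayeredCrystal K.c₀ (chartGen₁ st₀.L) (chartGen₂ st₀.L) st₀.w₁
  tame₀ : IsTameIndexing K.C₁ (chartGen₁ st₀.L) (chartGen₂ st₀.L) st₀.w₁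
  coer₀ : CoerciveZ (layeredKernel (chartGen₁ st₀.L) (chartGen₂ st₀.L) st₀.w₁) K.κ₀
  D₀ : st₀.D = 0
  DM₀ : st₀.DM = 0
  xS : x ∈ S
  xR : ‖x‖ < 8 * K.R
  hX₀ : atomOf S Ψ₀ (chartGen₁ st₀.L) (chartGen₂ st₀.L) st₀.w₁ X₀ = x
  lin : LinearisationDefectP
  CT : ∀ z v : E3, 27 / 32 ≤ ‖z‖ → ‖v‖ ≤ 1 / 4 → ‖defectKernel z v‖ ≤ K.CT * ‖v‖ ^ 2
  HC : ∀ (a b : E3) (w : ℤ → E3) (c C κ : ℝ), K.c₀ / 2 ≤ c → C ≤ 2 * K.C₁ → K.κ₀ / 2 ≤ κ → IsLayeredCrystal c a b w →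
    IsTameIndexing C a b w → CoerciveZ (layeredKernel a b w) κ → HCPackage K.κ₁ K.ϱ a b w
  LD : ∀ (a b : E3) (w : ℤ → E3) (c C κ : ℝ), K.c₀ / 2 ≤ c → C ≤ 2 * K.C₁ → K.κ₀ / 2 ≤ κ → IsLayeredCrystal c a b w →
    IsTameIndexing C a b w → CoerciveZ (layeredKernel a b w) κ → ModalDecayAt K.CL K.ϱ K.tC K.n₁ a b w ∧ ModeRigidAt K.CL K.ϱ K.n₁ a b w
  TF : ∀ (L : E3 ≃L[ℝ] E3) (w : ℤ → E3), IsEquilChart K.a (1 / 25) 3 L w → ∀ Ψ : E3 → E3,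
    Set.BijOn Ψ S (LayeredHom (L : E3 →L[ℝ] E3) w) → (∀ x ∈ S, ∀ p ∈ S, dist p x ≤ 4 → dist (Ψ p) (Ψ x) ≤ 9) →
    (∀ x ∈ S, ∀ p ∈ S, dist (Ψ p) (Ψ x) ≤ 3 → dist p x ≤ 8) → ∀ x ∈ S, ∀ t τ Θ : ℝ, 8 * K.ϱ ≤ t → t < τ → 0 ≤ Θ →
    (∀ ρ : ℝ, τ ≤ ρ → bondEnergy (S ∩ ball x ρ) (fun p => p - Ψ p) ≤ Θ * (ρ / τ) * nK (S ∩ ball x ρ)) →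
    ∀ φ : E3 → E3, (∀ y : E3, y ∉ S ∩ ball x t → φ y = 0) →
      |∑ᶠ y ∈ S ∩ ball x t, ⟪tailForce K.ϱ S (LayeredHom (L : E3 →L[ℝ] E3) w) Ψ y, φ y⟫_ℝ| ≤
        (K.εf * Real.sqrt (bondEnergy (S ∩ ball x τ) (fun p => p - Ψ p)) +
          K.AT * Real.sqrt (Θ * nK (S ∩ ball x τ)) / max (τ - t) 1) * Real.sqrt (bondEnergy (S ∩ ball x τ) φ)
  RC : ∀ (s Λ ν κ c C m : ℝ), K.κ₀ / 2 ≤ κ → K.c₀ / 2 ≤ c → C ≤ 2 * K.C₁ → 0 ≤ m → m ≤ K.m₀ → s + K.CR * m ≤ 1 / 25 →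
    Λ + K.CR * m ≤ 3 → ν + K.CR * m ≤ 1 / 1000 → ∀ (L : E3 ≃L[ℝ] E3) (w w₁ : ℤ → E3), IsEquilChart K.a s Λ L w →
    IsEnergyNear ν (LayeredHom (L : E3 →L[ℝ] E3) w) → Layered (chartGen₁ L) (chartGen₂ L) w₁ = LayeredHom (L : E3 →L[ℝ] E3) w →
    IsLayeredCrystal c (chartGen₁ L) (chartGen₂ L) w₁ → IsTameIndexing C (chartGen₁ L) (chartGen₂ L) w₁ →
    CoerciveZ (layeredKernel (chartGen₁ L) (chartGen₂ L) w₁) κ → ∀ M : Cell 2 → ℤ → E3, IsTruncMode K.ϱ (chartGen₁ L) (chartGen₂ L) w₁ M →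
    IsIdxLipschitz m M → ∃ (L' : E3 ≃L[ℝ] E3) (w' w₁' : ℤ → E3), IsEquilChart K.a (s + K.CR * m) (Λ + K.CR * m) L' w' ∧
      IsEnergyNear (ν + K.CR * m) (LayeredHom (L' : E3 →L[ℝ] E3) w') ∧ Layered (chartGen₁ L') (chartGen₂ L') w₁' = LayeredHom (L' : E3 →L[ℝ] E3) w' ∧
      IsLayeredCrystal (c - K.CR * m) (chartGen₁ L') (chartGen₂ L') w₁' ∧ IsTameIndexing (C + K.CR * m) (chartGen₁ L') (chartGen₂ L') w₁' ∧
      CoerciveZ (layeredKernel (chartGen₁ L') (chartGen₂ L') w₁') (κ - K.CR * m) ∧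
      ∀ X Y : Cell 2 × ℤ, ‖(lsite (chartGen₁ L') (chartGen₂ L') w₁' Y.1 Y.2 - lsite (chartGen₁ L) (chartGen₂ L) w₁ Y.1 Y.2 - M Y.1 Y.2) -
        (lsite (chartGen₁ L') (chartGen₂ L') w₁' X.1 X.2 - lsite (chartGen₁ L) (chartGen₂ L) w₁ X.1 X.2 - M X.1 X.2)‖ ≤ (K.CR * m ^ 2 + K.ε * m) * dist X Y

/-! ### XO.3  The invariant -/

/-- the certified state of level `i`. [this file, g59] -/
structure LevOK (K : SBK) (S : Set E3) (Ψ₀ : E3 → E3) (st₀ : Lev) (X₀ : Cell 2 × ℤ) (i : ℕ) (lv : Lev) : Prop where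
  chart : IsEquilChart K.a (1 / 50 + K.CR * lv.DM) (2 + K.CR * lv.DM) lv.L lv.w
  near : IsEnergyNear (1 / 2000 + K.CR * lv.DM) (LayeredHom (lv.L : E3 →L[ℝ] E3) lv.w)
  lay : Layered (chartGen₁ lv.L) (chartGen₂ lv.L) lv.w₁ = LayeredHom (lv.L : E3 →L[ℝ] E3) lv.w
  cryst : IsLayeredCrystal (K.c₀ - K.CR * lv.DM) (chartGen₁ lv.L) (chartGen₂ lv.L) lv.w₁
  tame : IsTameIndexing (K.C₁ + K.CR * lv.DM) (chartGen₁ lv.L) (chartGen₂ lv.L) lv.w₁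
  coer : CoerciveZ (layeredKernel (chartGen₁ lv.L) (chartGen₂ lv.L) lv.w₁) (K.κ₀ - K.CR * lv.DM)
  DM0 : 0 ≤ lv.DM
  DMle : lv.DM ≤ K.μpart i
  D0 : 0 ≤ lv.D
  Dle : lv.D ≤ 2 * lv.DM
  energy : idxEnergy (levφ S Ψ₀ st₀ lv) (idxBall X₀ (K.n i)) ≤ K.p i * ((idxBall X₀ (K.n i)).ncard : ℝ)

/-- ★ the TOWER INVARIANT after `ℓ` levels (module docstring XO.3). [this file, g59] -/
structure TowerInv (K : SBK) (S : Set E3) (Ψ₀ : E3 → E3) (st₀ : Lev) (X₀ : Cell 2 × ℤ) (ℓ : ℕ) (lev : ℕ → Lev) : Prop where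
  zero : lev 0 = st₀
  levOK : ∀ i, i ≤ ℓ → LevOK K S Ψ₀ st₀ X₀ i (lev i)
  lip : ∀ i, i ≤ ℓ → ∀ k, k ≤ i →
    IsIdxLipschitz ((lev i).D - (lev k).D) (fun γ m => lsite (chartGen₁ (lev i).L) (chartGen₂ (lev i).L) (lev i).w₁ γ m -
      lsite (chartGen₁ (lev k).L) (chartGen₂ (lev k).L) (lev k).w₁ γ m) ∧ (lev k).D ≤ (lev i).D
  step : ∀ i, i < ℓ → (lev (i + 1)).D - (lev i).D ≤ 2 * Real.sqrt (K.Cm * K.p i)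

/-! ### XO.4  Consequences of the invariant at a level -/

section Conseq

variable {K : SBK} {S : Set E3} {Ψ₀ : E3 → E3} {st₀ : Lev} {x : E3} {X₀ : Cell 2 × ℤ}

/-- `TH.hδ` (docstring added by the landing lane; see the module docstring). [formal bookkeeping] -/
theorem TH.hδ (T : TH K S Ψ₀ st₀ x X₀) : 0 < K.δ := T.ok.hδ
/-- `TH.sep` (docstring added by the landing lane; see the module docstring). [formal bookkeeping] -/
theorem TH.sep (T : TH K S Ψ₀ st₀ x X₀) : IsSep K.δ S := T.door.2.1
/-- `TH.cleanP` (docstring added by the landing lane; see the module docstring). [formal bookkeeping] -/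
theorem TH.cleanP (T : TH K S Ψ₀ st₀ x X₀) : IsCleanP 1 (μS S) := T.door.2.2.1
/-- `TH.nash` (docstring added by the landing lane; see the module docstring). [formal bookkeeping] -/
theorem TH.nash (T : TH K S Ψ₀ st₀ x X₀) : IsNash (μS S) := T.door.2.2.2.1
/-- chart 0's registration is a bijection onto its layered structure. -/
theorem TH.bij₀ (T : TH K S Ψ₀ st₀ x X₀) : BijOn Ψ₀ S (Layered (chartGen₁ st₀.L) (chartGen₂ st₀.L) st₀.w₁) := by
  rw [T.lay₀]; exact T.reg.1
/-- `TH.reg'` (docstring added by the landing lane; see the module docstring). [formal bookkeeping] -/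
theorem TH.reg' (T : TH K S Ψ₀ st₀ x X₀) : IsGlobalReg K.Cg K.η K.R S (Layered (chartGen₁ st₀.L) (chartGen₂ st₀.L) st₀.w₁) Ψ₀ := by
  rw [T.lay₀]; exact T.reg
/-- `TH.clean₀` (docstring added by the landing lane; see the module docstring). [formal bookkeeping] -/
theorem TH.clean₀ (T : TH K S Ψ₀ st₀ x X₀) : IsClean (μS (Layered (chartGen₁ st₀.L) (chartGen₂ st₀.L) st₀.w₁)) := by
  rw [T.lay₀]; exact T.chart₀.2.2.2.1
/-- `TH.fwd₀` (docstring added by the landing lane; see the module docstring). [formal bookkeeping] -/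
theorem TH.fwd₀ (T : TH K S Ψ₀ st₀ x X₀) : ∀ y ∈ S, ∀ p ∈ S, dist p y ≤ 4 → dist (Ψ₀ p) (Ψ₀ y) ≤ 8 := T.reg.2.1
/-- `TH.bwd₀` (docstring added by the landing lane; see the module docstring). [formal bookkeeping] -/
theorem TH.bwd₀ (T : TH K S Ψ₀ st₀ x X₀) : ∀ y ∈ S, ∀ p ∈ S, dist (Ψ₀ p) (Ψ₀ y) ≤ 4 → dist p y ≤ 8 := T.reg.2.2.1
/-- `TH.c₀_pos` (docstring added by the landing lane; see the module docstring). [formal bookkeeping] -/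
theorem TH.c₀_pos (T : TH K S Ψ₀ st₀ x X₀) : 0 < K.c₀ := T.ok.hc₀

variable {i : ℕ} {lv : Lev}

/-- the certificate constants of a level on the tower sit above the floors. -/
theorem LevOK.floors (T : TH K S Ψ₀ st₀ x X₀) (h : LevOK K S Ψ₀ st₀ X₀ i lv) (hi : K.nlo ≤ K.n i) :
    K.CR * lv.DM ≤ K.CR * K.μM ∧ K.c₀ / 2 ≤ K.c₀ - K.CR * lv.DM ∧ K.C₁ + K.CR * lv.DM ≤ 2 * K.C₁ ∧ K.κ₀ / 2 ≤ K.κ₀ - K.CR * lv.DM ∧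
      0 < K.c₀ - K.CR * lv.DM ∧ lv.D ≤ 2 * K.μM ∧ 0 ≤ K.CR * lv.DM := by
  have hK := T.ok
  have h1 : lv.DM ≤ K.μM := h.DMle.trans (SBK.μpart_le_μM hK hi)
  have hCR : 0 ≤ K.CR := by linarith [hK.hCR]
  have h2 : K.CR * lv.DM ≤ K.CR * K.μM := mul_le_mul_of_nonneg_left h1 hCR
  have h3 := hK.hdc; have h4 := hK.hdκ; have h5 := hK.hdC; have h6 := hK.hc₀
  have h7 : 0 ≤ K.CR * lv.DM := mul_nonneg hCR h.DM0
  refine ⟨h2, by linarith, by linarith, by linarith, by linarith, ?_, h7⟩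
  linarith [h.Dle]

/-- `LevOK.c_pos` (docstring added by the landing lane; see the module docstring). [formal bookkeeping] -/
theorem LevOK.c_pos (T : TH K S Ψ₀ st₀ x X₀) (h : LevOK K S Ψ₀ st₀ X₀ i lv) (hi : K.nlo ≤ K.n i) : 0 < K.c₀ - K.CR * lv.DM :=
  (h.floors T hi).2.2.2.2.1

/-- `LevOK.clean` (docstring added by the landing lane; see the module docstring). [formal bookkeeping] -/
theorem LevOK.clean (h : LevOK K S Ψ₀ st₀ X₀ i lv) : IsClean (μS (Layered (chartGen₁ lv.L) (chartGen₂ lv.L) lv.w₁)) := by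
  rw [h.lay]; exact h.chart.2.2.2.1
/-- `LevOK.nashH` (docstring added by the landing lane; see the module docstring). [formal bookkeeping] -/
theorem LevOK.nashH (h : LevOK K S Ψ₀ st₀ X₀ i lv) : IsNash (μS (Layered (chartGen₁ lv.L) (chartGen₂ lv.L) lv.w₁)) := by
  rw [h.lay]; exact h.chart.2.2.2.2

/-- the registration of a level is a bijection onto the level's layered structure. -/
theorem LevOK.bij (T : TH K S Ψ₀ st₀ x X₀) (h : LevOK K S Ψ₀ st₀ X₀ i lv) (hi : K.nlo ≤ K.n i) :
    BijOn (levΨ Ψ₀ st₀ lv) S (Layered (chartGen₁ lv.L) (chartGen₂ lv.L) lv.w₁) :=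
  bijOn_transReg T.bij₀ T.c₀_pos T.cryst₀ (h.c_pos T hi) h.cryst

/-- the chart of a level is in the class `(1/25, 3)` of (I4ˢ). -/
theorem LevOK.chart' (T : TH K S Ψ₀ st₀ x X₀) (h : LevOK K S Ψ₀ st₀ X₀ i lv) (hi : K.nlo ≤ K.n i) : IsEquilChart K.a (1 / 25) 3 lv.L lv.w := by
  have hK := T.ok
  obtain ⟨h1, -, -, -, -, -, h7⟩ := h.floors T hi
  have hs := hK.hds
  exact h.chart.mono hK.ha.le (by linarith) (by linarith)

/-- ★ TEAR-FREENESS of a level's registration (`4 ↦ 9`, `3 ↦ 8`): XE `tearFree_transReg` with the drift `D ≤ 2μ_M ≤ c₀/16` (`OK.htear`). -/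
theorem TowerInv.tearFree (T : TH K S Ψ₀ st₀ x X₀) {ℓ : ℕ} {lev : ℕ → Lev} (hT : TowerInv K S Ψ₀ st₀ X₀ ℓ lev) (hi : i ≤ ℓ)
    (hn : K.nlo ≤ K.n i) :
    (∀ y ∈ S, ∀ p ∈ S, dist p y ≤ 4 → dist (levΨ Ψ₀ st₀ (lev i) p) (levΨ Ψ₀ st₀ (lev i) y) ≤ 9) ∧
      (∀ y ∈ S, ∀ p ∈ S, dist (levΨ Ψ₀ st₀ (lev i) p) (levΨ Ψ₀ st₀ (lev i) y) ≤ 3 → dist p y ≤ 8) := by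
  have hK := T.ok
  have h := hT.levOK i hi
  obtain ⟨hlip, -⟩ := hT.lip i hi 0 (Nat.zero_le i)
  rw [hT.zero, T.D₀, sub_zero] at hlip
  obtain ⟨-, h2, -, -, h5, h6, -⟩ := h.floors T hn
  have htear := hK.htear
  exact tearFree_transReg T.bij₀ T.c₀_pos T.cryst₀ h5 h.cryst hlip h.D0 (by linarith) (by linarith) T.fwd₀ T.bwd₀

/-- the norm of the centre atom. -/
theorem TH.norm_x (T : TH K S Ψ₀ st₀ x X₀) : ‖atomOf S Ψ₀ (chartGen₁ st₀.L) (chartGen₂ st₀.L) st₀.w₁ X₀‖ < 8 * K.R := by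
  rw [T.hX₀]; exact T.xR

/-- ★ the COHERENCE REGION: the `(28/25)(6C₁(2ϱ/c₀)+8)`-neighbourhoods of the atoms indexed by the comparison window `B_{X₀, m}` (`m ≤ Kw·n₀`) lie in the root
window `9R` (`OK.hwin`), where `Ψ₀` is `(ϑ₁, ω₁)`-coherent. -/
theorem TH.coh_region (T : TH K S Ψ₀ st₀ x X₀) {m r : ℝ} (hm : m ≤ K.Kw * K.n0) (hr : r ≤ 28 / 25 * (6 * K.C₁ * (2 * K.ϱ / K.c₀) + 8))
    {X : Cell 2 × ℤ} (hX : X ∈ idxBallF X₀ m) :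
    S ∩ closedBall (atomOf S Ψ₀ (chartGen₁ st₀.L) (chartGen₂ st₀.L) st₀.w₁ X) r ⊆ atomsIn (μS S) 0 (9 * K.R) := by
  have hK := T.ok
  have hX' : X ∈ idxBall X₀ m := by rw [← coe_idxBallF]; exact hX
  refine inter_closedBall_atomOf_subset_atomsIn T.bij₀ T.iso T.clean₀ T.tame₀ X₀ hX' ?_
  have h1 := T.norm_x
  have h2 := hK.hwin
  have hC₁ := (SBK.C₁_pos hK).le
  have h3 : 28 / 25 * (6 * K.C₁ * m + 8) ≤ 28 / 25 * (6 * K.C₁ * (K.Kw * K.n0) + 8) := by nlinarith [mul_le_mul_of_nonneg_left hm hC₁]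
  have h4 : 0 ≤ 28 / 25 * (6 * K.C₁ + 8) := by positivity
  linarith

/-! #### Scale facts of a level on the tower -/

/-- `SBK.one_le_n` (docstring added by the landing lane; see the module docstring). [formal bookkeeping] -/
theorem SBK.one_le_n {K : SBK} (hK : K.OK) {i : ℕ} (hi : K.nlo ≤ K.n i) : 1 ≤ K.n i := hK.hnlo.trans hi
/-- `SBK.t_ge` (docstring added by the landing lane; see the module docstring). [formal bookkeeping] -/
theorem SBK.t_ge {K : SBK} (hK : K.OK) (i : ℕ) : 8 * K.ϱ + 10 ≤ K.t i ∧ 18 ≤ K.t i := by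
  unfold SBK.t; have := SBK.n_pos hK i; have := SBK.C₁_pos hK; have := hK.hϱ
  constructor <;> nlinarith
/-- `SBK.τ_eq` (docstring added by the landing lane; see the module docstring). [formal bookkeeping] -/
theorem SBK.τ_eq {K : SBK} (i : ℕ) : K.τ i = 2 * K.t i := rfl
/-- `SBK.τ_le_R` (docstring added by the landing lane; see the module docstring). [formal bookkeeping] -/
theorem SBK.τ_le_R {K : SBK} (hK : K.OK) (i : ℕ) : K.τ i ≤ K.R := by
  unfold SBK.τ SBK.t
  have h1 := hK.hτR
  have h2 : K.n i ≤ K.n0 := by rw [← SBK.n_zero]; exact SBK.n_anti hK (Nat.zero_le i)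
  have hC := (SBK.C₁_pos hK).le
  nlinarith [mul_le_mul_of_nonneg_left h2 hC]

/-! #### The level-0 instance of the invariant -/

/-- `levφ` of chart 0 itself is the pulled-back displacement of `Ψ₀`. -/
theorem TH.levφ_zero (T : TH K S Ψ₀ st₀ x X₀) : levφ S Ψ₀ st₀ st₀ = pullDisp S Ψ₀ (chartGen₁ st₀.L) (chartGen₂ st₀.L) st₀.w₁ := by
  rw [levφ_def, pullDisp_transReg T.bij₀ T.c₀_pos T.cryst₀ T.c₀_pos T.cryst₀]
  funext γ m; rfl

/-- ★ the REGISTRATION ENERGY of chart 0 on the top window: `E(φ₀)(B_{X₀, n₀}) ≤ P₀·n₀³ ≤ p 0·#B_{n₀}` (XL `idxEnergy_pullDisp_top_le`, `OK.hreg`). -/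
theorem TH.energy_zero (T : TH K S Ψ₀ st₀ x X₀) :
    idxEnergy (levφ S Ψ₀ st₀ st₀) (idxBall X₀ (K.n 0)) ≤ K.p 0 * ((idxBall X₀ (K.n 0)).ncard : ℝ) := by
  have hK := T.ok
  rw [T.levφ_zero, SBK.n_zero]
  have hR : 0 < K.R := by linarith [hK.hR]
  have hn0 := SBK.n0_pos hK
  have hC₁ := (SBK.C₁_pos hK).le
  have hwin : ‖atomOf S Ψ₀ (chartGen₁ st₀.L) (chartGen₂ st₀.L) st₀.w₁ X₀‖ + 28 / 25 * (6 * K.C₁ * K.n0 + 8) + 28 / 25 * (6 * K.C₁ + 8) ≤ 9 * K.R := by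
    have h1 := T.norm_x
    have h2 := hK.hwin
    have h3 : K.n0 ≤ K.Kw * K.n0 := le_mul_of_one_le_left hn0.le (SBK.one_le_Kw hK)
    have h4 : 0 ≤ 28 / 25 * (6 * K.C₁ * (2 * K.ϱ / K.c₀) + 8) := by have := hK.hϱ; have := hK.hc₀; positivity
    nlinarith [mul_le_mul_of_nonneg_left h3 hC₁]
  have h1 := idxEnergy_pullDisp_top_le T.bij₀ T.iso T.clean₀ T.tame₀ T.c₀_pos T.cryst₀ T.hδ T.sep hR T.reg' X₀ hwin
  have h2 := nK_atomsIn_le T.hδ T.sep (D := 9 * K.R) (by positivity)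
  have hdB : 0 ≤ dictB K.C₁ K.δ := by unfold dictB; have := T.hδ; positivity
  have h3 : dictB K.C₁ K.δ * (9 * K.Cg * K.η * nK (atomsIn (μS S) 0 (9 * K.R))) ≤
      dictB K.C₁ K.δ * (9 * K.Cg * K.η * (2 * (9 * K.R + 1) / K.δ + 1) ^ 3) := by
    have : 0 ≤ 9 * K.Cg * K.η := by have := hK.hCg; have := hK.hη; positivity
    exact mul_le_mul_of_nonneg_left (mul_le_mul_of_nonneg_left h2 this) hdB
  have h4 := hK.hreg
  have h5 : K.n0 ^ 3 ≤ ((idxBall X₀ K.n0).ncard : ℝ) := cube_le_ncard_idxBall X₀ hn0.le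
  have h6 : K.P₀ ≤ K.p 0 := by
    unfold SBK.p; rw [pow_zero, mul_one, SBK.n_zero]
    have := hK.hG₀; have : 0 ≤ K.G₀ / K.n0 ^ 2 := by positivity
    linarith
  have h7 : K.P₀ * K.n0 ^ 3 ≤ K.p 0 * ((idxBall X₀ K.n0).ncard : ℝ) := mul_le_mul h6 h5 (by positivity) (SBK.p_nonneg hK 0)
  linarith

/-- ★ the invariant holds at level 0 with the constant tower `fun _ => st₀`. [this file, g59] -/
theorem TH.towerInv_zero (T : TH K S Ψ₀ st₀ x X₀) : TowerInv K S Ψ₀ st₀ X₀ 0 (fun _ => st₀) := by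
  refine ⟨rfl, fun i hi => ?_, fun i hi k hk => ?_, fun i hi => (Nat.not_lt_zero i hi).elim⟩
  · obtain rfl : i = 0 := Nat.le_zero.1 hi
    refine ⟨?_, ?_, T.lay₀, ?_, ?_, ?_, ?_, ?_, ?_, ?_, T.energy_zero⟩
    · rw [T.DM₀, mul_zero, add_zero, add_zero]; exact T.chart₀
    · rw [T.DM₀, mul_zero, add_zero]; exact T.near₀
    · rw [T.DM₀, mul_zero, sub_zero]; exact T.cryst₀
    · rw [T.DM₀, mul_zero, add_zero]; exact T.tame₀
    · rw [T.DM₀, mul_zero, sub_zero]; exact T.coer₀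
    · rw [T.DM₀]
    · rw [T.DM₀, SBK.μpart_zero]
    · rw [T.D₀]
    · rw [T.D₀, T.DM₀, mul_zero]
  · refine ⟨fun X Y => ?_, le_rfl⟩
    obtain rfl : i = 0 := Nat.le_zero.1 hi
    obtain rfl : k = 0 := Nat.le_zero.1 hk
    simp

end Conseq


end Summit.AtomisticToContinuum.Crystallization.Theorems.ChartedZeroExcessLayeredLatticeLiouville

end
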